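import Summits.Ventures.QEC.Census.FoldPiv
import Mathlib.Data.LawfulXor
import HarnessLib

/-!
# Fold enumeration — completeness of the fibre enumerator (`fiber_complete`)

Cell `qec`, PARTITION row type-11 ("kernel C"), soundness layer 3 of `Census/FoldDefs.lean`: the
Plotkin `(u|u+v)` decomposition of a big word along a fold step.  Under the finitely many index facts
`G.OK` (decided per level): every big word is `embW a ⊕ parW b` with `a, b` its section / partner parts
(`recon`), its fold is `a ⊕ b`, its weight is `|a| + |b| = |a ⊕ b| + 2|a ∧ b|` (`popc_eq_parts`), and a
kernel word of weight `≤ W` folding onto `t` is produced by the enumerator `fiber G C W (bitsOf ns 0 t)`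
from the outside set `e* = bits (a ∧ b)` and the selection `x* = a|_{supp t}` — which the scan and the
certified solver list (`FoldPiv`).  Result: `fiber_complete`.  Folklore linear algebra / coding theory
(van Lint's repeated-root = `(u|u+v)` structure), formalised at the bitmask level.
-/

namespace Summit.Ventures.QEC.Census.Fold

open Summit.Ventures.QEC.Census

/-! ## Small generic facts -/

/-- `lin_lt_two_pow`: lin lt two pow (auxiliary lemma of the fold-certificate soundness chain). -/
theorem lin_lt_two_pow (g : ℕ → ℕ) (n m : ℕ) (hg : ∀ k, k < n → g k < 2 ^ m) : ∀ u, lin g n 0 u < 2 ^ m := by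
  induction n generalizing g with
  | zero => intro u; exact Nat.two_pow_pos m
  | succ n ih =>
    intro u
    rw [lin_succ_zero]
    refine Nat.xor_lt_two_pow ?_ (ih (fun k => g (k + 1)) (fun k hk => hg (k + 1) (by omega)) _)
    split
    · exact hg 0 (by omega)
    · exact Nat.two_pow_pos m

/-- `xor_eq_of_xor_xor_eq_zero`: xor eq of xor xor eq zero (auxiliary lemma of the fold-certificate soundness chain). -/
theorem xor_eq_of_xor_xor_eq_zero {x y z : ℕ} (h : x ^^^ y ^^^ z = 0) : y = z ^^^ x := by
  have h' : x ^^^ y = z := by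
    have := congrArg (· ^^^ z) h
    simpa [Nat.xor_assoc] using this
  rw [← h', Nat.xor_comm x y, Nat.xor_assoc, Nat.xor_self, Nat.xor_zero]

/-- `and_two_pow_eq`: and two pow eq (auxiliary lemma of the fold-certificate soundness chain). -/
theorem and_two_pow_eq (a j : ℕ) : a &&& 2 ^ j = if a.testBit j then 2 ^ j else 0 := by
  apply Nat.eq_of_testBit_eq; intro i
  rw [Nat.testBit_and, Nat.testBit_two_pow]
  by_cases hji : j = i
  · subst hji; cases h : a.testBit j <;> simp
  · cases h : a.testBit j <;> simp [hji]

/-- `and_xor_self_decomp`: and xor self decomp (auxiliary lemma of the fold-certificate soundness chain). -/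
theorem and_xor_self_decomp (a b : ℕ) : (a &&& b) ^^^ (a &&& (a ^^^ b)) = a := by
  apply Nat.eq_of_testBit_eq; intro i
  simp only [Nat.testBit_xor, Nat.testBit_and]
  cases a.testBit i <;> cases b.testBit i <;> rfl

/-- `two_mul_xor`: two mul xor (auxiliary lemma of the fold-certificate soundness chain). -/
theorem two_mul_xor (x y : ℕ) : 2 * (x ^^^ y) = 2 * x ^^^ 2 * y := by
  apply Nat.eq_of_testBit_eq; intro i
  rw [Nat.testBit_xor]
  cases i with
  | zero => simp [Nat.testBit_zero, Nat.mul_mod_right]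
  | succ i => simp [Nat.testBit_succ, Nat.testBit_xor]

/-- `maskOf_reverse`: maskOf reverse (auxiliary lemma of the fold-certificate soundness chain). -/
theorem maskOf_reverse (L : List ℕ) : maskOf L.reverse = maskOf L := by
  induction L with
  | nil => rfl
  | cons j L ih => rw [List.reverse_cons, maskOf_append, ih, maskOf_cons, maskOf_cons, maskOf_nil, Nat.xor_zero,
      Nat.xor_comm]

/-- Bits of `maskOf` of a duplicate-free list = membership. -/
theorem testBit_maskOf_nodup (L : List ℕ) (hL : L.Nodup) (i : ℕ) : (maskOf L).testBit i = decide (i ∈ L) := by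
  induction L with
  | nil => simp
  | cons a L ih =>
    rw [List.nodup_cons] at hL
    rw [maskOf_cons, Nat.testBit_xor, ih hL.2, Nat.testBit_two_pow]
    by_cases hai : a = i
    · subst hai; simp [hL.1]
    · have hia : ¬ i = a := fun e => hai e.symm
      simp [hai, hia]

/-- `maskOf_filter_testBit`: maskOf filter testBit (auxiliary lemma of the fold-certificate soundness chain). -/
theorem maskOf_filter_testBit (m : ℕ) (L : List ℕ) : maskOf (L.filter fun j => m.testBit j) = m &&& maskOf L := by
  induction L with
  | nil => simp
  | cons j L ih =>
    rw [List.filter_cons, maskOf_cons, Nat.and_xor_distrib_left, and_two_pow_eq]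
    by_cases h : m.testBit j = true
    · rw [if_pos (by simpa using h), maskOf_cons, ih, if_pos h]
    · rw [if_neg (by simpa using h), ih, if_neg h, Nat.zero_xor]

/-- `popc_xor_of_and_eq_zero`: popc xor of and eq zero (auxiliary lemma of the fold-certificate soundness chain). -/
theorem popc_xor_of_and_eq_zero {n x y : ℕ} (h : x &&& y = 0) : popc n (x ^^^ y) = popc n x + popc n y := by
  have := popc_xor_add n x y
  rw [h, popc_zero] at this
  omega

/-- `mem_bitsOf_iff`: mem bitsOf iff (auxiliary lemma of the fold-certificate soundness chain). -/
theorem mem_bitsOf_iff (n : ℕ) : ∀ (i0 u j : ℕ), j ∈ bitsOf n i0 u ↔ i0 ≤ j ∧ j < i0 + n ∧ u.testBit (j - i0) = true := by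
  induction n with
  | zero => intro i0 u j; simp only [bitsOf, List.not_mem_nil, Nat.add_zero, false_iff, not_and]; intros; omega
  | succ n ih =>
    intro i0 u j
    rw [bitsOf_succ]
    have ih' := ih (i0 + 1) (u / 2) j
    split
    · rename_i h
      rw [List.mem_cons, ih']
      constructor
      · rintro (rfl | ⟨h1, h2, h3⟩)
        · exact ⟨le_rfl, by omega, by simpa [Nat.testBit_zero] using h⟩
        · refine ⟨by omega, by omega, ?_⟩
          rw [Nat.testBit_div_two] at h3
          rwa [show j - i0 = j - (i0 + 1) + 1 from by omega]
      · rintro ⟨h1, h2, h3⟩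
        by_cases hj : j = i0
        · exact Or.inl hj
        · refine Or.inr ⟨by omega, by omega, ?_⟩
          rw [Nat.testBit_div_two, show j - (i0 + 1) + 1 = j - i0 from by omega]; exact h3
    · rename_i h
      rw [ih']
      constructor
      · rintro ⟨h1, h2, h3⟩
        refine ⟨by omega, by omega, ?_⟩
        rw [Nat.testBit_div_two] at h3
        rwa [show j - i0 = j - (i0 + 1) + 1 from by omega]
      · rintro ⟨h1, h2, h3⟩
        have hj : j ≠ i0 := by
          rintro rfl
          rw [Nat.sub_self, Nat.testBit_zero] at h3
          simp at h3; omega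
        refine ⟨by omega, by omega, ?_⟩
        rw [Nat.testBit_div_two, show j - (i0 + 1) + 1 = j - i0 from by omega]; exact h3

/-- `mem_bitsOf_zero_iff`: mem bitsOf zero iff (auxiliary lemma of the fold-certificate soundness chain). -/
theorem mem_bitsOf_zero_iff {n u j : ℕ} : j ∈ bitsOf n 0 u ↔ j < n ∧ u.testBit j = true := by
  rw [mem_bitsOf_iff]; simp

/-- `nodup_bitsOf`: nodup bitsOf (auxiliary lemma of the fold-certificate soundness chain). -/
theorem nodup_bitsOf (n : ℕ) : ∀ (i0 u : ℕ), (bitsOf n i0 u).Nodup := by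
  induction n with
  | zero => intro i0 u; simp [bitsOf]
  | succ n ih =>
    intro i0 u
    rw [bitsOf_succ]
    split
    · rw [List.nodup_cons]
      refine ⟨fun h => ?_, ih _ _⟩
      have := mem_bitsOf_bound n (i0 + 1) (u / 2) i0 h; omega
    · exact ih _ _

/-- `restrictTo` shifts with its origin. -/
theorem restrictTo_succ (R : List ℕ) : ∀ (k0 v : ℕ), restrictTo R (k0 + 1) v = 2 * restrictTo R k0 v := by
  induction R with
  | nil => intro k0 v; simp [restrictTo]
  | cons r R ih =>
    intro k0 v
    rw [restrictTo, restrictTo, ih, two_mul_xor]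
    congr 1
    split <;> simp [Nat.pow_succ, Nat.mul_comm]

/-- `restrictTo_lt`: restrictTo lt (auxiliary lemma of the fold-certificate soundness chain). -/
theorem restrictTo_lt (R : List ℕ) : ∀ (k0 v : ℕ), restrictTo R k0 v < 2 ^ (k0 + R.length) := by
  induction R with
  | nil => intro k0 v; simp [restrictTo]
  | cons r R ih =>
    intro k0 v
    rw [restrictTo, List.length_cons]
    refine Nat.xor_lt_two_pow ?_ (by have := ih (k0 + 1) v; rwa [show k0 + 1 + R.length = k0 + (R.length + 1) from by omega] at this)
    split
    · exact Nat.pow_lt_pow_right (by norm_num) (by omega)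
    · exact Nat.two_pow_pos _

/-- The selection word of `P` by `x`: `⊕_{k ∈ x} e_{P[k]}`. -/
theorem selP_restrictTo (a : ℕ) (P : List ℕ) :
    lin (fun k => 2 ^ P.getD k 0) P.length 0 (restrictTo P 0 a) = a &&& maskOf P := by
  induction P with
  | nil => simp [restrictTo]
  | cons j P ih =>
    rw [List.length_cons, lin_succ_zero, restrictTo, restrictTo_succ, maskOf_cons, Nat.and_xor_distrib_left,
      and_two_pow_eq]
    simp only [List.getD_cons_zero, List.getD_cons_succ, Nat.pow_zero]
    have hmod : ((if a.testBit j = true then 1 else 0) ^^^ 2 * restrictTo P 0 a) % 2 = (if a.testBit j = true then 1 else 0) := by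
      rw [xor_mod_two]; split <;> simp [Nat.mul_mod_right]
    have hdiv : ((if a.testBit j = true then 1 else 0) ^^^ 2 * restrictTo P 0 a) / 2 = restrictTo P 0 a := by
      rw [xor_div_two]; split <;> simp
    rw [hmod, hdiv, ih]
    cases a.testBit j <;> simp

/-- `selXor_map_eq_lin`: selXor map eq lin (auxiliary lemma of the fold-certificate soundness chain). -/
theorem selXor_map_eq_lin (f : ℕ → ℕ) (ns : ℕ) (P : List ℕ) (hP : ∀ j ∈ P, j < ns) (x : ℕ) :
    selXor (P.map f) x = lin f ns 0 (lin (fun k => 2 ^ P.getD k 0) P.length 0 x) := by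
  rw [selXor, List.length_map, lin_lin]
  refine lin_congr (i0 := 0) (fun k hk => ?_) x
  rw [Nat.zero_add, List.getD_eq_getElem?_getD, List.getElem?_map, List.getElem?_eq_getElem hk, Option.map_some,
    Option.getD_some, List.getD_eq_getElem?_getD, List.getElem?_eq_getElem hk, Option.getD_some,
    lin_two_pow _ _ 0 _ (hP _ (List.getElem_mem hk)), Nat.zero_add]

namespace Geo

variable {G : Geo}

/-! ## Additivity of the step maps -/

/-- `embW_xor`: embW xor (auxiliary lemma of the fold-certificate soundness chain). -/
theorem embW_xor (G : Geo) (x y : ℕ) : G.embW (x ^^^ y) = G.embW x ^^^ G.embW y := lin_xor _ _ _ _ _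
/-- `parW_xor`: parW xor (auxiliary lemma of the fold-certificate soundness chain). -/
theorem parW_xor (G : Geo) (x y : ℕ) : G.parW (x ^^^ y) = G.parW x ^^^ G.parW y := lin_xor _ _ _ _ _
/-- `foldW_xor`: foldW xor (auxiliary lemma of the fold-certificate soundness chain). -/
theorem foldW_xor (G : Geo) (x y : ℕ) : G.foldW (x ^^^ y) = G.foldW x ^^^ G.foldW y := lin_xor _ _ _ _ _
/-- `embW_zero`: embW zero (auxiliary lemma of the fold-certificate soundness chain). -/
@[simp] theorem embW_zero (G : Geo) : G.embW 0 = 0 := lin_zero _ _ _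
/-- `parW_zero`: parW zero (auxiliary lemma of the fold-certificate soundness chain). -/
@[simp] theorem parW_zero (G : Geo) : G.parW 0 = 0 := lin_zero _ _ _


/-- `embW_two_pow`: embW two pow (auxiliary lemma of the fold-certificate soundness chain). -/
theorem embW_two_pow {j : ℕ} (hj : j < G.ns) : G.embW (2 ^ j) = 2 ^ G.emb j := by
  rw [embW, lin_two_pow _ _ 0 j hj, Nat.zero_add]
/-- `parW_two_pow`: parW two pow (auxiliary lemma of the fold-certificate soundness chain). -/
theorem parW_two_pow {j : ℕ} (hj : j < G.ns) : G.parW (2 ^ j) = 2 ^ G.partner (G.emb j) := by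
  rw [parW, lin_two_pow _ _ 0 j hj, Nat.zero_add]
/-- The fold splits into section and partner parts. -/
theorem foldW_eq_parts (u : ℕ) : G.foldW u = G.aPart u ^^^ G.bPart u := by
  rw [foldW, aPart, bPart, ← lin_xor_fun]
  exact lin_congr (i0 := 0) (fun J _ => by cases G.isEmb (0 + J) <;> simp) u
/-- **RECONSTRUCTION**: a big word is its section part on the section points plus its partner part on
the partner points. -/
theorem recon (hG : G.OK) {u : ℕ} (hu : u < 2 ^ G.n) : u = G.embW (G.aPart u) ^^^ G.parW (G.bPart u) := by
  rw [aPart, bPart, map_lin_of_xor G.embW (embW_zero G) (embW_xor G), map_lin_of_xor G.parW (parW_zero G) (parW_xor G),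
    ← lin_xor_fun]
  conv_lhs => rw [← Nat.mod_eq_of_lt hu, ← lin_pow_self]
  refine lin_congr (i0 := 0) (fun J hJ => ?_) u
  rw [Nat.zero_add]
  rcases hG.cover J hJ with h | h
  · have hE : G.isEmb J = true := by simp [isEmb, h]
    rw [hE]; simp only [if_true]
    rw [embW_two_pow (hG.foldIdx_lt J hJ), h, parW_zero, Nat.xor_zero]
  · have hE : G.isEmb J = false := by
      simp only [isEmb, beq_eq_false_iff_ne]
      intro h'
      exact hG.partner_emb_ne _ (hG.foldIdx_lt J hJ) (h.trans h'.symm)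
    rw [hE]; simp only [Bool.false_eq_true, if_false]
    rw [parW_two_pow (hG.foldIdx_lt J hJ), h, embW_zero, Nat.zero_xor]
/-- Injectivity of the section on the window. -/
theorem emb_inj (hG : G.OK) {j₁ j₂ : ℕ} (h₁ : j₁ < G.ns) (h₂ : j₂ < G.ns) (h : G.emb j₁ = G.emb j₂) : j₁ = j₂ := by
  rw [← hG.fold_emb j₁ h₁, ← hG.fold_emb j₂ h₂, h]
/-- `partner_emb_inj`: partner emb inj (auxiliary lemma of the fold-certificate soundness chain). -/
theorem partner_emb_inj (hG : G.OK) {j₁ j₂ : ℕ} (h₁ : j₁ < G.ns) (h₂ : j₂ < G.ns)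
    (h : G.partner (G.emb j₁) = G.partner (G.emb j₂)) : j₁ = j₂ := by
  apply emb_inj hG h₁ h₂
  rw [← hG.partner_partner _ (hG.emb_lt j₁ h₁), h, hG.partner_partner _ (hG.emb_lt j₂ h₂)]
/-- `testBit_embW`: testBit embW (auxiliary lemma of the fold-certificate soundness chain). -/
theorem testBit_embW (hG : G.OK) {y J : ℕ} : (G.embW y).testBit J = true ↔ ∃ j, j < G.ns ∧ y.testBit j = true ∧ G.emb j = J := by
  rw [embW, testBit_lin_pow_iff]
  · simp
  · intro k₁ k₂ h₁ h₂ h; simp only [Nat.zero_add] at h; exact emb_inj hG h₁ h₂ h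
/-- `testBit_parW`: testBit parW (auxiliary lemma of the fold-certificate soundness chain). -/
theorem testBit_parW (hG : G.OK) {z J : ℕ} :
    (G.parW z).testBit J = true ↔ ∃ j, j < G.ns ∧ z.testBit j = true ∧ G.partner (G.emb j) = J := by
  rw [parW, testBit_lin_pow_iff]
  · simp
  · intro k₁ k₂ h₁ h₂ h; simp only [Nat.zero_add] at h; exact partner_emb_inj hG h₁ h₂ h
/-- Section and partner placements are disjoint. -/
theorem embW_and_parW (hG : G.OK) (y z : ℕ) : G.embW y &&& G.parW z = 0 := by
  apply Nat.eq_of_testBit_eq; intro J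
  rw [Nat.testBit_and, Nat.zero_testBit, Bool.and_eq_false_iff]
  by_contra h
  push Not at h
  obtain ⟨j, hj, -, hJ⟩ := (testBit_embW hG).1 (by simpa using h.1)
  obtain ⟨j', hj', -, hJ'⟩ := (testBit_parW hG).1 (by simpa using h.2)
  have : j' = j := by
    have := hG.fold_partner _ (hG.emb_lt j' hj')
    rw [hJ', ← hJ, hG.fold_emb j hj, hG.fold_emb j' hj'] at this
    exact this.symm
  subst this
  exact hG.partner_emb_ne j' hj' (hJ'.trans hJ.symm)
/-- `popc_embW`: popc embW (auxiliary lemma of the fold-certificate soundness chain). -/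
theorem popc_embW (hG : G.OK) (y : ℕ) : popc G.n (G.embW y) = popc G.ns y :=
  popc_lin_pow_inj _ _ _ _ (fun _ _ h₁ h₂ h => emb_inj hG h₁ h₂ h) hG.emb_lt
/-- `popc_parW`: popc parW (auxiliary lemma of the fold-certificate soundness chain). -/
theorem popc_parW (hG : G.OK) (z : ℕ) : popc G.n (G.parW z) = popc G.ns z :=
  popc_lin_pow_inj _ _ _ _ (fun _ _ h₁ h₂ h => partner_emb_inj hG h₁ h₂ h)
    (fun k hk => hG.partner_lt _ (hG.emb_lt k hk))
/-- **WEIGHT**: `|u| = |a| + |b|`. -/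
theorem popc_eq_parts (hG : G.OK) {u : ℕ} (hu : u < 2 ^ G.n) :
    popc G.n u = popc G.ns (G.aPart u) + popc G.ns (G.bPart u) := by
  conv_lhs => rw [recon hG hu]
  rw [popc_xor_of_and_eq_zero (embW_and_parW hG _ _), popc_embW hG, popc_parW hG]
/-- `aPart_lt`: aPart lt (auxiliary lemma of the fold-certificate soundness chain). -/
theorem aPart_lt (hG : G.OK) (u : ℕ) : G.aPart u < 2 ^ G.ns :=
  lin_lt_two_pow _ _ _ (fun J hJ => by
    split
    · exact Nat.pow_lt_pow_right (by norm_num) (hG.foldIdx_lt J hJ)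
    · exact Nat.two_pow_pos _) u
/-- `bPart_lt`: bPart lt (auxiliary lemma of the fold-certificate soundness chain). -/
theorem bPart_lt (hG : G.OK) (u : ℕ) : G.bPart u < 2 ^ G.ns :=
  lin_lt_two_pow _ _ _ (fun J hJ => by
    split
    · exact Nat.two_pow_pos _
    · exact Nat.pow_lt_pow_right (by norm_num) (hG.foldIdx_lt J hJ)) u

/-! ## The words produced by `mkWord` -/
/-- `maskOf_map_emb`: maskOf map emb (auxiliary lemma of the fold-certificate soundness chain). -/
theorem maskOf_map_emb (e : List ℕ) (he : ∀ j ∈ e, j < G.ns) : maskOf (e.map G.emb) = G.embW (maskOf e) := by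
  rw [maskOf, xorIdx_map, embW, ← xorIdx_eq_lin _ _ _ he]; rfl
/-- `maskOf_map_partner_emb`: maskOf map partner emb (auxiliary lemma of the fold-certificate soundness chain). -/
theorem maskOf_map_partner_emb (e : List ℕ) (he : ∀ j ∈ e, j < G.ns) :
    maskOf (e.map fun j => G.partner (G.emb j)) = G.parW (maskOf e) := by
  rw [maskOf, xorIdx_map, parW, ← xorIdx_eq_lin _ _ _ he]; rfl
/-- `maskOf_xorSelIdx`: maskOf xorSelIdx (auxiliary lemma of the fold-certificate soundness chain). -/
theorem maskOf_xorSelIdx (P : List ℕ) (hP : ∀ j ∈ P, j < G.ns) (x : ℕ) :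
    maskOf (mkWord.xorSelIdx G P x) =
      G.embW (lin (fun k => 2 ^ P.getD k 0) P.length 0 x) ^^^
        G.parW (maskOf P ^^^ lin (fun k => 2 ^ P.getD k 0) P.length 0 x) := by
  induction P generalizing x with
  | nil => simp [mkWord.xorSelIdx]
  | cons j P ih =>
    have hj : j < G.ns := hP j (by simp)
    rw [mkWord.xorSelIdx, maskOf_cons, ih (fun i hi => hP i (by simp [hi])) (x / 2), List.length_cons, lin_succ_zero,
      maskOf_cons]
    simp only [List.getD_cons_zero, List.getD_cons_succ]
    split
    · simp only [embW_xor, parW_xor, embW_two_pow hj, Nat.xor_assoc, Nat.xor_left_comm,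
        xor_cancel_left]
    · simp only [parW_xor, parW_two_pow hj, Nat.xor_assoc, Nat.xor_left_comm, Nat.zero_xor]
/-- `maskOf_mkWord`: maskOf mkWord (auxiliary lemma of the fold-certificate soundness chain). -/
theorem maskOf_mkWord (P e : List ℕ) (hP : ∀ j ∈ P, j < G.ns) (he : ∀ j ∈ e, j < G.ns) (x : ℕ) :
    maskOf (mkWord G P e x) =
      G.embW (maskOf e ^^^ lin (fun k => 2 ^ P.getD k 0) P.length 0 x) ^^^
        G.parW (maskOf e ^^^ (maskOf P ^^^ lin (fun k => 2 ^ P.getD k 0) P.length 0 x)) := by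
  rw [mkWord, maskOf_append, maskOf_append, maskOf_map_emb e he, maskOf_map_partner_emb e he,
    maskOf_xorSelIdx P hP, embW_xor, parW_xor G (maskOf e)]
  simp only [Nat.xor_assoc, Nat.xor_left_comm]
/-- Every index produced by `mkWord` is a big index. -/
theorem mkWord_bound (hG : G.OK) (P e : List ℕ) (hP : ∀ j ∈ P, j < G.ns) (he : ∀ j ∈ e, j < G.ns) (x : ℕ) :
    ∀ J ∈ mkWord G P e x, J < G.n := by
  intro J hJ
  rw [mkWord, List.mem_append, List.mem_append] at hJ
  rcases hJ with (hJ | hJ) | hJ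
  · rw [List.mem_map] at hJ; obtain ⟨j, hj, rfl⟩ := hJ; exact hG.emb_lt j (he j hj)
  · rw [List.mem_map] at hJ; obtain ⟨j, hj, rfl⟩ := hJ; exact hG.partner_lt _ (hG.emb_lt j (he j hj))
  · suffices h : ∀ (Q : List ℕ) (y : ℕ), (∀ j ∈ Q, j < G.ns) → ∀ J ∈ mkWord.xorSelIdx G Q y, J < G.n from
      h P x hP J hJ
    intro Q
    induction Q with
    | nil => intro y _ J hJ; simp [mkWord.xorSelIdx] at hJ
    | cons j Q ih =>
      intro y hQ J hJ
      rw [mkWord.xorSelIdx, List.mem_cons] at hJ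
      rcases hJ with rfl | hJ
      · split
        · exact hG.emb_lt j (hQ j (by simp))
        · exact hG.partner_lt _ (hG.emb_lt j (hQ j (by simp)))
      · exact ih (y / 2) (fun i hi => hQ i (by simp [hi])) J hJ
/-- The length of a produced word. -/
theorem length_mkWord (P e : List ℕ) (x : ℕ) : (mkWord G P e x).length = e.length + e.length + P.length := by
  rw [mkWord, List.length_append, List.length_append, List.length_map, List.length_map]
  congr 1
  induction P generalizing x with
  | nil => rfl
  | cons j P ih => rw [mkWord.xorSelIdx, List.length_cons, ih, List.length_cons]

/-! ## Syndromes through the step maps -/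
/-- `lin_col_embW`: lin col embW (auxiliary lemma of the fold-certificate soundness chain). -/
theorem lin_col_embW (hG : G.OK) (C : TCode) (y : ℕ) : lin C.col G.n 0 (G.embW y) = lin (fun j => C.col (G.emb j)) G.ns 0 y := by
  rw [embW, lin_lin]
  exact lin_congr (i0 := 0) (fun j hj => by rw [Nat.zero_add, lin_two_pow _ _ 0 _ (hG.emb_lt j hj), Nat.zero_add]) y
/-- `lin_col_parW`: lin col parW (auxiliary lemma of the fold-certificate soundness chain). -/
theorem lin_col_parW (hG : G.OK) (C : TCode) (y : ℕ) :
    lin C.col G.n 0 (G.parW y) = lin (fun j => C.col (G.partner (G.emb j))) G.ns 0 y := by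
  rw [parW, lin_lin]
  exact lin_congr (i0 := 0) (fun j hj => by
    rw [Nat.zero_add, lin_two_pow _ _ 0 _ (hG.partner_lt _ (hG.emb_lt j hj)), Nat.zero_add]) y

/-! ## The main theorem -/

end Geo

end Summit.Ventures.QEC.Census.Fold
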